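import Summits.SmoothPoincare4.SmoothPoincare4.Theorems.ContractibleTwistedDoubleStandard.Negative.SphereAcyclicBisection
import Literature.Topology.FourManifolds.CerfGammaFourProofs

/-!
# `AcyclicBisectionRigidity` — negative-side support: the twin / non-twin decomposition

Support lemmas for the crux
`Summit.SmoothPoincare4.SmoothPoincare4.Theses.ConvexBisection.AcyclicBisectionRigidity`
(stmt-SmoothPoincare4-10507), from the standing disprover's work file
`Cruxes/AcyclicBisectionRigidity/Disproof.lean` §9e (every statement inline). The picked line
`minimal-factorisation-rigidity` has a lever (`stub_minimalFactorisationTwins`: the halves of an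
acyclic common-contact bisection of a homotopy sphere are CONTACT TWINS — a diffeomorphism
`Φ : W₁ ≅ W₂` carrying the complex tangencies of `J₁` to those of `J₂` along `∂W₁`) and two
residual twisted-double stubs. Splitting the crux by excluded middle on "the halves are contact
twins" shows exactly what each part is worth:

* `crux_iff_twinSector_and_nonTwinSector` — the crux is the conjunction of its TWIN SECTOR
  (bisections whose halves are contact twins) and its NON-TWIN SECTOR;
* `twinSector_iff_twistedDoubleStubs` — the twin sector is EQUIVALENT to the conjunction of the
  two residual stubs (`stub_contractibleTwinTwistedDouble ∧ stub_nonContractibleTwinTwistedDouble`),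
  with NO appeal to the lever (re-parametrise the second half by `e₂ ∘ Φ`);
* `nonTwinSector_of_twinsLever` — the lever says precisely that the non-twin sector is EMPTY.
So if the lever is refuted (the disprover rates it probably false: Disproof §§9c–9f), the line
still proves the twin sector and the crux's exact residue is the non-twin sector, an SPC4-shielded
statement about cork twists of `S⁴` along Stein-compatibly embedded exotic acyclic pairs.
-/

noncomputable section

-- The namespace is prescribed by the crux protocol (`Summit.<P>.<Sub>.Theorems.<Crux>.Negative`
-- with `P = Sub = SmoothPoincare4`), hence the duplicated component.
set_option linter.dupNamespace false

open scoped Manifold ContDiff Topology ContinuousMap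
open Set Function Literature.Geometry.Symplectic Literature.AlgebraicTopology.SingularHomology
  CategoryTheory.Limits

namespace Summit.SmoothPoincare4.SmoothPoincare4.Theorems.AcyclicBisectionRigidity.Negative

open Summit.SmoothPoincare4.SmoothPoincare4.Theses.ConvexBisection

/-- **Re-parametrising a half keeps the seam planes matched.** If `Φ : W₁ ≅ W₂` carries `ξ₁` to
`ξ₂` on `∂W₁` and the planes pushed forward by `e₁`, `e₂` agree on the seam, then so do the
planes pushed forward by `e₁` and `e₂ ∘ Φ`, both read with `ξ₁` (chain rule; seam points are
boundary points by the seam condition and injectivity of `e₂`). [folklore] -/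
theorem seamPlanes_comp_diffeomorph
    {M : Type} [TopologicalSpace M] [ChartedSpace (EuclideanSpace ℝ (Fin 4)) M]
    {W₁ : Type} [TopologicalSpace W₁] [ChartedSpace (EuclideanHalfSpace 4) W₁] [IsManifold (𝓡∂ 4) ∞ W₁]
    {W₂ : Type} [TopologicalSpace W₂] [ChartedSpace (EuclideanHalfSpace 4) W₂] [IsManifold (𝓡∂ 4) ∞ W₂]
    (ξ₁ : W₁ → Submodule ℝ (EuclideanSpace ℝ (Fin 4))) (ξ₂ : W₂ → Submodule ℝ (EuclideanSpace ℝ (Fin 4)))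
    {e₁ : W₁ → M} {e₂ : W₂ → M}
    (he₂ : Manifold.IsSmoothEmbedding (𝓡∂ 4) (𝓡 4) ∞ e₂)
    (hseam₂ : range e₁ ∩ range e₂ = e₂ '' (𝓡∂ 4).boundary W₂)
    (hξ : ∀ w₁ w₂, e₁ w₁ = e₂ w₂ →
      Submodule.map (mfderiv (𝓡∂ 4) (𝓡 4) e₁ w₁).toLinearMap (ξ₁ w₁) =
      Submodule.map (mfderiv (𝓡∂ 4) (𝓡 4) e₂ w₂).toLinearMap (ξ₂ w₂))
    (Φ : W₁ ≃ₘ⟮𝓡∂ 4, 𝓡∂ 4⟯ W₂)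
    (hΦ : ∀ w, w ∈ (𝓡∂ 4).boundary W₁ →
      Submodule.map (mfderiv (𝓡∂ 4) (𝓡∂ 4) Φ w).toLinearMap (ξ₁ w) = ξ₂ (Φ w)) :
    ∀ w w', e₁ w = (e₂ ∘ Φ) w' →
      Submodule.map (mfderiv (𝓡∂ 4) (𝓡 4) e₁ w).toLinearMap (ξ₁ w) =
      Submodule.map (mfderiv (𝓡∂ 4) (𝓡 4) (e₂ ∘ Φ) w').toLinearMap (ξ₁ w') := by
  intro w w' h
  have hn : (∞ : WithTop ℕ∞) ≠ 0 := by simp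
  have hmem : e₂ (Φ w') ∈ range e₁ ∩ range e₂ := ⟨⟨w, h⟩, ⟨Φ w', rfl⟩⟩
  rw [hseam₂] at hmem
  obtain ⟨v, hv, hve⟩ := hmem
  have hv' : v = Φ w' := he₂.isEmbedding.injective hve
  have hb₂ : Φ w' ∈ (𝓡∂ 4).boundary W₂ := hv' ▸ hv
  have hb₁ : w' ∈ (𝓡∂ 4).boundary W₁ := by
    have : w' ∈ Φ ⁻¹' (𝓡∂ 4).boundary W₂ := hb₂
    rwa [Φ.preimage_boundary hn] at this
  have hd₂ : MDifferentiableAt (𝓡∂ 4) (𝓡 4) e₂ (Φ w') :=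
    he₂.contMDiff.mdifferentiableAt (by simp)
  have hdΦ : MDifferentiableAt (𝓡∂ 4) (𝓡∂ 4) Φ w' := Φ.mdifferentiable (by simp) w'
  have hcomp : mfderiv (𝓡∂ 4) (𝓡 4) (e₂ ∘ Φ) w' =
      (mfderiv (𝓡∂ 4) (𝓡 4) e₂ (Φ w')).comp (mfderiv (𝓡∂ 4) (𝓡∂ 4) Φ w') :=
    mfderiv_comp w' hd₂ hdΦ
  have key : Submodule.map (mfderiv (𝓡∂ 4) (𝓡 4) (e₂ ∘ Φ) w').toLinearMap (ξ₁ w') =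
      Submodule.map (mfderiv (𝓡∂ 4) (𝓡 4) e₂ (Φ w')).toLinearMap
        (Submodule.map (mfderiv (𝓡∂ 4) (𝓡∂ 4) Φ w').toLinearMap (ξ₁ w')) := by
    rw [← Submodule.map_comp]
    congr 1
    rw [hcomp]
    rfl
  rw [key, hΦ w' hb₁]
  exact hξ w (Φ w') h

/-- **The crux is the conjunction of its twin and non-twin sectors** (excluded middle on the
existence of contact-twin data `Φ : W₁ ≅ W₂`, `dΦ(ξ₁) = ξ₂` on `∂W₁`). [folklore] -/
theorem crux_iff_twinSector_and_nonTwinSector : AcyclicBisectionRigidity ↔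
    ((∀ (M : Type) [TopologicalSpace M] [T2Space M] [SecondCountableTopology M]
      [ChartedSpace (EuclideanSpace ℝ (Fin 4)) M] [IsManifold (𝓡 4) ∞ M],
      M ≃ₕ Metric.sphere (0 : EuclideanSpace ℝ (Fin 5)) 1 →
      (∃ (W₁ : Type) (_ : TopologicalSpace W₁) (_ : ChartedSpace (EuclideanHalfSpace 4) W₁)
        (_ : IsManifold (𝓡∂ 4) ∞ W₁) (_ : CompactSpace W₁) (W₂ : Type) (_ : TopologicalSpace W₂)
        (_ : ChartedSpace (EuclideanHalfSpace 4) W₂) (_ : IsManifold (𝓡∂ 4) ∞ W₂) (_ : CompactSpace W₂)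
        (J₁ : SteinStructure W₁) (J₂ : SteinStructure W₂) (e₁ : W₁ → M) (e₂ : W₂ → M),
        Manifold.IsSmoothEmbedding (𝓡∂ 4) (𝓡 4) ∞ e₁ ∧ Manifold.IsSmoothEmbedding (𝓡∂ 4) (𝓡 4) ∞ e₂ ∧
        Set.range e₁ ∪ Set.range e₂ = Set.univ ∧
        Set.range e₁ ∩ Set.range e₂ = e₁ '' (𝓡∂ 4).boundary W₁ ∧
        Set.range e₁ ∩ Set.range e₂ = e₂ '' (𝓡∂ 4).boundary W₂ ∧
        (∀ w₁ w₂, e₁ w₁ = e₂ w₂ →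
          Submodule.map (mfderiv (𝓡∂ 4) (𝓡 4) e₁ w₁).toLinearMap (contactPlane J₁.J w₁) =
          Submodule.map (mfderiv (𝓡∂ 4) (𝓡 4) e₂ w₂).toLinearMap (contactPlane J₂.J w₂)) ∧
        (∀ k, 0 < k → IsZero (singularHomology ℚ ℚ W₁ k) ∧ IsZero (singularHomology ℚ ℚ W₂ k)) ∧
        (∃ Φ : W₁ ≃ₘ⟮𝓡∂ 4, 𝓡∂ 4⟯ W₂, ∀ w, w ∈ (𝓡∂ 4).boundary W₁ →
          Submodule.map (mfderiv (𝓡∂ 4) (𝓡∂ 4) Φ w).toLinearMap (contactPlane J₁.J w) =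
            contactPlane J₂.J (Φ w))) →
      Nonempty (M ≃ₘ⟮𝓡 4, 𝓡 4⟯ Metric.sphere (0 : EuclideanSpace ℝ (Fin 5)) 1)) ∧
    (∀ (M : Type) [TopologicalSpace M] [T2Space M] [SecondCountableTopology M]
      [ChartedSpace (EuclideanSpace ℝ (Fin 4)) M] [IsManifold (𝓡 4) ∞ M],
      M ≃ₕ Metric.sphere (0 : EuclideanSpace ℝ (Fin 5)) 1 →
      (∃ (W₁ : Type) (_ : TopologicalSpace W₁) (_ : ChartedSpace (EuclideanHalfSpace 4) W₁)
        (_ : IsManifold (𝓡∂ 4) ∞ W₁) (_ : CompactSpace W₁) (W₂ : Type) (_ : TopologicalSpace W₂)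
        (_ : ChartedSpace (EuclideanHalfSpace 4) W₂) (_ : IsManifold (𝓡∂ 4) ∞ W₂) (_ : CompactSpace W₂)
        (J₁ : SteinStructure W₁) (J₂ : SteinStructure W₂) (e₁ : W₁ → M) (e₂ : W₂ → M),
        Manifold.IsSmoothEmbedding (𝓡∂ 4) (𝓡 4) ∞ e₁ ∧ Manifold.IsSmoothEmbedding (𝓡∂ 4) (𝓡 4) ∞ e₂ ∧
        Set.range e₁ ∪ Set.range e₂ = Set.univ ∧
        Set.range e₁ ∩ Set.range e₂ = e₁ '' (𝓡∂ 4).boundary W₁ ∧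
        Set.range e₁ ∩ Set.range e₂ = e₂ '' (𝓡∂ 4).boundary W₂ ∧
        (∀ w₁ w₂, e₁ w₁ = e₂ w₂ →
          Submodule.map (mfderiv (𝓡∂ 4) (𝓡 4) e₁ w₁).toLinearMap (contactPlane J₁.J w₁) =
          Submodule.map (mfderiv (𝓡∂ 4) (𝓡 4) e₂ w₂).toLinearMap (contactPlane J₂.J w₂)) ∧
        (∀ k, 0 < k → IsZero (singularHomology ℚ ℚ W₁ k) ∧ IsZero (singularHomology ℚ ℚ W₂ k)) ∧
        ¬ (∃ Φ : W₁ ≃ₘ⟮𝓡∂ 4, 𝓡∂ 4⟯ W₂, ∀ w, w ∈ (𝓡∂ 4).boundary W₁ →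
          Submodule.map (mfderiv (𝓡∂ 4) (𝓡∂ 4) Φ w).toLinearMap (contactPlane J₁.J w) =
            contactPlane J₂.J (Φ w))) →
      Nonempty (M ≃ₘ⟮𝓡 4, 𝓡 4⟯ Metric.sphere (0 : EuclideanSpace ℝ (Fin 5)) 1))) := by
  constructor
  · intro h
    refine ⟨fun M _ _ _ _ _ hM hb => ?_, fun M _ _ _ _ _ hM hb => ?_⟩
    · obtain ⟨W₁, _, _, _, _, W₂, _, _, _, _, J₁, J₂, e₁, e₂, he₁, he₂, hcover, hseam₁, hseam₂, hξ,
        hac, -⟩ := hb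
      exact h M hM ⟨W₁, _, _, _, _, W₂, _, _, _, _, J₁, J₂, e₁, e₂, he₁, he₂, hcover, hseam₁,
        hseam₂, hξ, hac⟩
    · obtain ⟨W₁, _, _, _, _, W₂, _, _, _, _, J₁, J₂, e₁, e₂, he₁, he₂, hcover, hseam₁, hseam₂, hξ,
        hac, -⟩ := hb
      exact h M hM ⟨W₁, _, _, _, _, W₂, _, _, _, _, J₁, J₂, e₁, e₂, he₁, he₂, hcover, hseam₁,
        hseam₂, hξ, hac⟩
  · rintro ⟨hT, hN⟩ M _ _ _ _ _ hM hb
    obtain ⟨W₁, _, _, _, _, W₂, _, _, _, _, J₁, J₂, e₁, e₂, he₁, he₂, hcover, hseam₁, hseam₂, hξ,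
      hac⟩ := hb
    by_cases ht : ∃ Φ : W₁ ≃ₘ⟮𝓡∂ 4, 𝓡∂ 4⟯ W₂, ∀ w, w ∈ (𝓡∂ 4).boundary W₁ →
        Submodule.map (mfderiv (𝓡∂ 4) (𝓡∂ 4) Φ w).toLinearMap (contactPlane J₁.J w) =
          contactPlane J₂.J (Φ w)
    · exact hT M hM ⟨W₁, _, _, _, _, W₂, _, _, _, _, J₁, J₂, e₁, e₂, he₁, he₂, hcover, hseam₁,
        hseam₂, hξ, hac, ht⟩
    · exact hN M hM ⟨W₁, _, _, _, _, W₂, _, _, _, _, J₁, J₂, e₁, e₂, he₁, he₂, hcover, hseam₁,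
        hseam₂, hξ, hac, ht⟩

/-- **The twin sector is EQUIVALENT to the conjunction of the two residual stubs of the line**
(`stub_contractibleTwinTwistedDouble`: a homotopy 4-sphere that is a contact twisted double of ONE
contractible Stein domain is `S⁴`; `stub_nonContractibleTwinTwistedDouble`: the same for a
ℚ-acyclic non-contractible domain) — with NO appeal to the lever. `→`: twin data on `(W, W; J, J)`
is reflexive (`Φ = refl`). `←`: re-parametrise the second half by `e₂ ∘ Φ` (tree lemma
`IsSmoothEmbedding.comp_diffeomorph`; `seamPlanes_comp_diffeomorph`) and case on
`ContractibleSpace W₁`. So the two residual stubs prove exactly the twin sector, lever or no lever.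
[folklore] -/
theorem twinSector_iff_twistedDoubleStubs :
    (∀ (M : Type) [TopologicalSpace M] [T2Space M] [SecondCountableTopology M]
      [ChartedSpace (EuclideanSpace ℝ (Fin 4)) M] [IsManifold (𝓡 4) ∞ M],
      M ≃ₕ Metric.sphere (0 : EuclideanSpace ℝ (Fin 5)) 1 →
      (∃ (W₁ : Type) (_ : TopologicalSpace W₁) (_ : ChartedSpace (EuclideanHalfSpace 4) W₁)
        (_ : IsManifold (𝓡∂ 4) ∞ W₁) (_ : CompactSpace W₁) (W₂ : Type) (_ : TopologicalSpace W₂)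
        (_ : ChartedSpace (EuclideanHalfSpace 4) W₂) (_ : IsManifold (𝓡∂ 4) ∞ W₂) (_ : CompactSpace W₂)
        (J₁ : SteinStructure W₁) (J₂ : SteinStructure W₂) (e₁ : W₁ → M) (e₂ : W₂ → M),
        Manifold.IsSmoothEmbedding (𝓡∂ 4) (𝓡 4) ∞ e₁ ∧ Manifold.IsSmoothEmbedding (𝓡∂ 4) (𝓡 4) ∞ e₂ ∧
        Set.range e₁ ∪ Set.range e₂ = Set.univ ∧
        Set.range e₁ ∩ Set.range e₂ = e₁ '' (𝓡∂ 4).boundary W₁ ∧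
        Set.range e₁ ∩ Set.range e₂ = e₂ '' (𝓡∂ 4).boundary W₂ ∧
        (∀ w₁ w₂, e₁ w₁ = e₂ w₂ →
          Submodule.map (mfderiv (𝓡∂ 4) (𝓡 4) e₁ w₁).toLinearMap (contactPlane J₁.J w₁) =
          Submodule.map (mfderiv (𝓡∂ 4) (𝓡 4) e₂ w₂).toLinearMap (contactPlane J₂.J w₂)) ∧
        (∀ k, 0 < k → IsZero (singularHomology ℚ ℚ W₁ k) ∧ IsZero (singularHomology ℚ ℚ W₂ k)) ∧
        (∃ Φ : W₁ ≃ₘ⟮𝓡∂ 4, 𝓡∂ 4⟯ W₂, ∀ w, w ∈ (𝓡∂ 4).boundary W₁ →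
          Submodule.map (mfderiv (𝓡∂ 4) (𝓡∂ 4) Φ w).toLinearMap (contactPlane J₁.J w) =
            contactPlane J₂.J (Φ w))) →
      Nonempty (M ≃ₘ⟮𝓡 4, 𝓡 4⟯ Metric.sphere (0 : EuclideanSpace ℝ (Fin 5)) 1)) ↔
    ((∀ (M : Type) [TopologicalSpace M] [T2Space M] [SecondCountableTopology M]
        [ChartedSpace (EuclideanSpace ℝ (Fin 4)) M] [IsManifold (𝓡 4) ∞ M]
        (_hM : M ≃ₕ Metric.sphere (0 : EuclideanSpace ℝ (Fin 5)) 1)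
        (W : Type) [TopologicalSpace W] [ChartedSpace (EuclideanHalfSpace 4) W] [IsManifold (𝓡∂ 4) ∞ W]
        [CompactSpace W] [ContractibleSpace W] (J : SteinStructure W) (e₁ e₂ : W → M)
        (_he₁ : Manifold.IsSmoothEmbedding (𝓡∂ 4) (𝓡 4) ∞ e₁)
        (_he₂ : Manifold.IsSmoothEmbedding (𝓡∂ 4) (𝓡 4) ∞ e₂)
        (_hcover : range e₁ ∪ range e₂ = univ)
        (_hseam₁ : range e₁ ∩ range e₂ = e₁ '' (𝓡∂ 4).boundary W)
        (_hseam₂ : range e₁ ∩ range e₂ = e₂ '' (𝓡∂ 4).boundary W)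
        (_hξ : ∀ w w', e₁ w = e₂ w' →
          Submodule.map (mfderiv (𝓡∂ 4) (𝓡 4) e₁ w).toLinearMap (contactPlane J.J w) =
          Submodule.map (mfderiv (𝓡∂ 4) (𝓡 4) e₂ w').toLinearMap (contactPlane J.J w')),
        Nonempty (M ≃ₘ⟮𝓡 4, 𝓡 4⟯ Metric.sphere (0 : EuclideanSpace ℝ (Fin 5)) 1)) ∧
      (∀ (M : Type) [TopologicalSpace M] [T2Space M] [SecondCountableTopology M]
        [ChartedSpace (EuclideanSpace ℝ (Fin 4)) M] [IsManifold (𝓡 4) ∞ M]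
        (_hM : M ≃ₕ Metric.sphere (0 : EuclideanSpace ℝ (Fin 5)) 1)
        (W : Type) [TopologicalSpace W] [ChartedSpace (EuclideanHalfSpace 4) W] [IsManifold (𝓡∂ 4) ∞ W]
        [CompactSpace W] (_hW : ¬ ContractibleSpace W) (J : SteinStructure W) (e₁ e₂ : W → M)
        (_he₁ : Manifold.IsSmoothEmbedding (𝓡∂ 4) (𝓡 4) ∞ e₁)
        (_he₂ : Manifold.IsSmoothEmbedding (𝓡∂ 4) (𝓡 4) ∞ e₂)
        (_hcover : range e₁ ∪ range e₂ = univ)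
        (_hseam₁ : range e₁ ∩ range e₂ = e₁ '' (𝓡∂ 4).boundary W)
        (_hseam₂ : range e₁ ∩ range e₂ = e₂ '' (𝓡∂ 4).boundary W)
        (_hξ : ∀ w w', e₁ w = e₂ w' →
          Submodule.map (mfderiv (𝓡∂ 4) (𝓡 4) e₁ w).toLinearMap (contactPlane J.J w) =
          Submodule.map (mfderiv (𝓡∂ 4) (𝓡 4) e₂ w').toLinearMap (contactPlane J.J w'))
        (_hac : ∀ k, 0 < k → IsZero (singularHomology ℚ ℚ W k)),
        Nonempty (M ≃ₘ⟮𝓡 4, 𝓡 4⟯ Metric.sphere (0 : EuclideanSpace ℝ (Fin 5)) 1))) := by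
  -- reflexivity of twin data
  have hrefl : ∀ {W : Type} [TopologicalSpace W] [ChartedSpace (EuclideanHalfSpace 4) W]
      [IsManifold (𝓡∂ 4) ∞ W] [CompactSpace W] (J : SteinStructure W),
      ∃ Φ : W ≃ₘ⟮𝓡∂ 4, 𝓡∂ 4⟯ W, ∀ w, w ∈ (𝓡∂ 4).boundary W →
        Submodule.map (mfderiv (𝓡∂ 4) (𝓡∂ 4) Φ w).toLinearMap (contactPlane J.J w) =
          contactPlane J.J (Φ w) := by
    intro W _ _ _ _ J
    refine ⟨Diffeomorph.refl _ _ _, fun w _ => ?_⟩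
    have h : ((Diffeomorph.refl (𝓡∂ 4) W ∞ : W ≃ₘ⟮𝓡∂ 4, 𝓡∂ 4⟯ W) : W → W) = id := rfl
    rw [h, mfderiv_id]
    exact Submodule.map_id _
  constructor
  · intro h
    refine ⟨?_, ?_⟩
    · intro M _ _ _ _ _ hM W _ _ _ _ _ J e₁ e₂ he₁ he₂ hcover hseam₁ hseam₂ hξ
      exact h M hM ⟨W, _, _, _, _, W, _, _, _, _, J, J, e₁, e₂, he₁, he₂, hcover, hseam₁, hseam₂, hξ,
        fun k hk => ⟨isZero_singularHomology_of_contractibleSpace ℚ ℚ (X := W) hk.ne',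
          isZero_singularHomology_of_contractibleSpace ℚ ℚ (X := W) hk.ne'⟩, hrefl J⟩
    · intro M _ _ _ _ _ hM W _ _ _ _ hW J e₁ e₂ he₁ he₂ hcover hseam₁ hseam₂ hξ hac
      exact h M hM ⟨W, _, _, _, _, W, _, _, _, _, J, J, e₁, e₂, he₁, he₂, hcover, hseam₁, hseam₂, hξ,
        fun k hk => ⟨hac k hk, hac k hk⟩, hrefl J⟩
  · rintro ⟨h₂, h₃⟩ M _ _ _ _ _ hM hb
    obtain ⟨W₁, _, _, _, _, W₂, _, _, _, _, J₁, J₂, e₁, e₂, he₁, he₂, hcover, hseam₁, hseam₂, hξ,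
      hac, Φ, hΦ⟩ := hb
    have hn : (∞ : WithTop ℕ∞) ≠ 0 := by simp
    have he₂' : Manifold.IsSmoothEmbedding (𝓡∂ 4) (𝓡 4) ∞ (e₂ ∘ Φ) := he₂.comp_diffeomorph Φ
    have hsurj : Function.Surjective (Φ : W₁ → W₂) := fun y => ⟨Φ.symm y, Φ.apply_symm_apply y⟩
    have hrange : range (e₂ ∘ Φ) = range e₂ := by
      rw [range_comp, hsurj.range_eq, image_univ]
    have hcover' : range e₁ ∪ range (e₂ ∘ Φ) = univ := by rw [hrange]; exact hcover
    have hseam₁' : range e₁ ∩ range (e₂ ∘ Φ) = e₁ '' (𝓡∂ 4).boundary W₁ := by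
      rw [hrange]; exact hseam₁
    have hseam₂' : range e₁ ∩ range (e₂ ∘ Φ) = (e₂ ∘ Φ) '' (𝓡∂ 4).boundary W₁ := by
      rw [hrange, image_comp, Φ.image_boundary hn]; exact hseam₂
    have hξ' := seamPlanes_comp_diffeomorph (fun w => contactPlane J₁.J w)
      (fun w => contactPlane J₂.J w) he₂ hseam₂ hξ Φ hΦ
    have hac₁ : ∀ k, 0 < k → IsZero (singularHomology ℚ ℚ W₁ k) := fun k hk => (hac k hk).1
    by_cases hW : ContractibleSpace W₁
    · exact h₂ M hM W₁ J₁ e₁ (e₂ ∘ Φ) he₁ he₂' hcover' hseam₁' hseam₂' hξ'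
    · exact h₃ M hM W₁ hW J₁ e₁ (e₂ ∘ Φ) he₁ he₂' hcover' hseam₁' hseam₂' hξ' hac₁

/-- **The lever says precisely that the non-twin sector is EMPTY**: `stub_minimalFactorisationTwins`
(∀-closure, verbatim) implies the non-twin sector vacuously — and this is its only contribution to
the crux. [folklore] -/
theorem nonTwinSector_of_twinsLever
    (h₁ : ∀ (M : Type) [TopologicalSpace M] [T2Space M] [SecondCountableTopology M]
      [ChartedSpace (EuclideanSpace ℝ (Fin 4)) M] [IsManifold (𝓡 4) ∞ M]
      (_hM : M ≃ₕ Metric.sphere (0 : EuclideanSpace ℝ (Fin 5)) 1)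
      (W₁ : Type) [TopologicalSpace W₁] [ChartedSpace (EuclideanHalfSpace 4) W₁] [IsManifold (𝓡∂ 4) ∞ W₁]
      [CompactSpace W₁] (W₂ : Type) [TopologicalSpace W₂] [ChartedSpace (EuclideanHalfSpace 4) W₂]
      [IsManifold (𝓡∂ 4) ∞ W₂] [CompactSpace W₂] (J₁ : SteinStructure W₁) (J₂ : SteinStructure W₂)
      (e₁ : W₁ → M) (e₂ : W₂ → M)
      (_he₁ : Manifold.IsSmoothEmbedding (𝓡∂ 4) (𝓡 4) ∞ e₁)
      (_he₂ : Manifold.IsSmoothEmbedding (𝓡∂ 4) (𝓡 4) ∞ e₂)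
      (_hcover : range e₁ ∪ range e₂ = univ)
      (_hseam₁ : range e₁ ∩ range e₂ = e₁ '' (𝓡∂ 4).boundary W₁)
      (_hseam₂ : range e₁ ∩ range e₂ = e₂ '' (𝓡∂ 4).boundary W₂)
      (_hξ : ∀ w₁ w₂, e₁ w₁ = e₂ w₂ →
        Submodule.map (mfderiv (𝓡∂ 4) (𝓡 4) e₁ w₁).toLinearMap (contactPlane J₁.J w₁) =
        Submodule.map (mfderiv (𝓡∂ 4) (𝓡 4) e₂ w₂).toLinearMap (contactPlane J₂.J w₂))
      (_hac : ∀ k, 0 < k → IsZero (singularHomology ℚ ℚ W₁ k) ∧ IsZero (singularHomology ℚ ℚ W₂ k)),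
      ∃ Φ : W₁ ≃ₘ⟮𝓡∂ 4, 𝓡∂ 4⟯ W₂, ∀ w, w ∈ (𝓡∂ 4).boundary W₁ →
        Submodule.map (mfderiv (𝓡∂ 4) (𝓡∂ 4) Φ w).toLinearMap (contactPlane J₁.J w) =
          contactPlane J₂.J (Φ w)) :
    ∀ (M : Type) [TopologicalSpace M] [T2Space M] [SecondCountableTopology M]
      [ChartedSpace (EuclideanSpace ℝ (Fin 4)) M] [IsManifold (𝓡 4) ∞ M],
      M ≃ₕ Metric.sphere (0 : EuclideanSpace ℝ (Fin 5)) 1 →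
      (∃ (W₁ : Type) (_ : TopologicalSpace W₁) (_ : ChartedSpace (EuclideanHalfSpace 4) W₁)
        (_ : IsManifold (𝓡∂ 4) ∞ W₁) (_ : CompactSpace W₁) (W₂ : Type) (_ : TopologicalSpace W₂)
        (_ : ChartedSpace (EuclideanHalfSpace 4) W₂) (_ : IsManifold (𝓡∂ 4) ∞ W₂) (_ : CompactSpace W₂)
        (J₁ : SteinStructure W₁) (J₂ : SteinStructure W₂) (e₁ : W₁ → M) (e₂ : W₂ → M),
        Manifold.IsSmoothEmbedding (𝓡∂ 4) (𝓡 4) ∞ e₁ ∧ Manifold.IsSmoothEmbedding (𝓡∂ 4) (𝓡 4) ∞ e₂ ∧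
        Set.range e₁ ∪ Set.range e₂ = Set.univ ∧
        Set.range e₁ ∩ Set.range e₂ = e₁ '' (𝓡∂ 4).boundary W₁ ∧
        Set.range e₁ ∩ Set.range e₂ = e₂ '' (𝓡∂ 4).boundary W₂ ∧
        (∀ w₁ w₂, e₁ w₁ = e₂ w₂ →
          Submodule.map (mfderiv (𝓡∂ 4) (𝓡 4) e₁ w₁).toLinearMap (contactPlane J₁.J w₁) =
          Submodule.map (mfderiv (𝓡∂ 4) (𝓡 4) e₂ w₂).toLinearMap (contactPlane J₂.J w₂)) ∧
        (∀ k, 0 < k → IsZero (singularHomology ℚ ℚ W₁ k) ∧ IsZero (singularHomology ℚ ℚ W₂ k)) ∧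
        ¬ (∃ Φ : W₁ ≃ₘ⟮𝓡∂ 4, 𝓡∂ 4⟯ W₂, ∀ w, w ∈ (𝓡∂ 4).boundary W₁ →
          Submodule.map (mfderiv (𝓡∂ 4) (𝓡∂ 4) Φ w).toLinearMap (contactPlane J₁.J w) =
            contactPlane J₂.J (Φ w))) →
      Nonempty (M ≃ₘ⟮𝓡 4, 𝓡 4⟯ Metric.sphere (0 : EuclideanSpace ℝ (Fin 5)) 1) := by
  intro M _ _ _ _ _ hM hb
  obtain ⟨W₁, _, _, _, _, W₂, _, _, _, _, J₁, J₂, e₁, e₂, he₁, he₂, hcover, hseam₁, hseam₂, hξ,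
    hac, ht⟩ := hb
  exact (ht (h₁ M hM W₁ W₂ J₁ J₂ e₁ e₂ he₁ he₂ hcover hseam₁ hseam₂ hξ hac)).elim

end Summit.SmoothPoincare4.SmoothPoincare4.Theorems.AcyclicBisectionRigidity.Negative
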